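/-
Copyright (c) 2026 the pub-hodgecm-mathlib formalisation cell (harness21).  Prover seat hodgecm-mathlib-K2Liu-p05 (g3), 2026-09-04
(Track B «K2-LIT», crux hLiu418 = stmt-HodgeConjecture-24832, socket #42F′, ROAD I v3, organ G2-Weil, sub-organ (G2-W3) rest (i):
the sixteen letter derivatives preserve the polynomial × Gaussian vectors — explicit Fock symbols; LEAD F0P6-plan (g12) M-156j (4)).
-/
import Summits.HodgeConjecture.HodgeConjecture.Theorems.K2LiuWeilDatumSmoothU22                -- (G2-W2): `u22LetterOp`, letter derivatives
import Literature.RepresentationTheory.KonnoKonno2007.JunctionHyperbolicFockMatrix             -- ★ `hypOpGen_binvPi_frame`, `hypPairSymb`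
import Literature.Analysis.SegalBargmann.SchwartzBargmannIntertwining                          -- ★ `unitaryOpPi_binvPi`, `binvPi_smul`
import HarnessLib

/-!
# (G2-W3 (i)) The letter derivatives of `𝔲(2,2)` PRESERVE the polynomial × Gaussian vectors `B⁻¹F`: explicit Fock symbols

Track B ∕ K2-LIT, hLiu418 = stmt-HodgeConjecture-24832, #42F′ ROAD I v3 organ G2-Weil, (G2.4) second half «stability of polynomial × Gaussian under
`dω(𝔲(2,2))`» (LEAD F0P6-plan (g12) RULING M-156j (4)).  Namespace `Summit.HodgeConjecture.HodgeConjecture.Cruxes.HLiu418.K2LiuWeilDatumSmoothU22` (continued).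
THEOREMS ONLY (no definition, no instance, no notation, no named fact, no `sorry`); `--supports stmt-HodgeConjecture-24832 --as helper`.

The `K`-finite vectors of the Schrödinger model are the polynomial × Gaussian vectors `B⁻¹F = binvPi F`, `F` a Fock polynomial (★ `FockKFiniteDense`).  The
explicit derivative vectors of (G2-W2) are `dωᵢ Φ = κOp e (kᵢ,1) (Gᵢ (κOp e (kᵢ⁻¹,1) Φ))` with `Gᵢ = hypOpGenC p q` (boosts) or `torusKGen e a b` (tori).  This file
reads them on `B⁻¹F` in the Fock model, entirely from ★ facts:
* §1 `κOp_binvPi` — the frame operators act by substitution: `κOp e k (B⁻¹F) = B⁻¹(vacScalar e k · F ∘ (ι k)⁻¹)` (★ `unitaryOpPi_binvPi`, [Folland1989, Prop. (4.39)]);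
* §2 **`u22LetterOp_boost_gen_binvPi`** — the BOOST generator: `hypOpGenC p q (B⁻¹F) = B⁻¹(i (Σ_s P_{(p,s),(q,s)} F − Σ_r P_{(p,r),(q,r)} F))`,
  `P_{k,k′} = π z_k z_{k′} + π⁻¹ ∂_k ∂_{k′}` (★ `hypOpGen_binvPi_frame`: degree `±2`, CREATION on the `S`-planes, ANNIHILATION on the `R`-planes), hence
  **`u22LetterOp_boost_deriv_binvPi`**: the full boost letter derivative `κOp (k,1) ∘ hypOpGenC p q ∘ κOp (k⁻¹,1)` maps `B⁻¹F` to `B⁻¹F′` with `F′` EXPLICIT —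
  the eight boost directions `Y_{pq}`, `Z_{pq}` of ★ `u22AdaptedBasis` preserve polynomial × Gaussian and raise∕lower the degree by `2`;
* §3 **`u22LetterOp_torus_op_hermitePi`** — the TORUS letters act on the Hermite basis by unimodular scalars (★ `torusOpPi_hermitePi`), so every torus letter
  preserves each line `ℂ · h_α` (degree-preserving; the generator is diagonal).
The remaining item of M-156j (4), the line cyclicity «polynomial × Gaussian ∩ U(1)-type = U(𝔭⁺)·vacuum», is NOT here (successor file; (R-gen) material).

HONEST LABEL: HC_CM is proved only modulo the 7 printed citations (2 remaining named inputs: hLiu418 = stmt-HodgeConjecture-24832, h413 =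
stmt-HodgeConjecture-24833) until rung 0 closes; organ capital for #42F′'s Road I, moves no counter.

## References
* [Folland1989] G. B. Folland, *Harmonic Analysis in Phase Space* (1989), §1.7, §4.2 (4.24), Prop. (4.39).
* [KashiwaraVergne1978] M. Kashiwara, M. Vergne, Invent. Math. 44 (1978), §5 (the `𝔭^±` parts act by `zz′` ∕ `∂∂′`).
-/

set_option autoImplicit false
set_option linter.dupNamespace false

noncomputable section

open scoped MatrixGroups Matrix Topology SchwartzMap ComplexConjugate
open Filter Complex MvPolynomial
open Literature.NumberTheory.Automorphic Literature.Analysis.SegalBargmann Literature.NumberTheory.Weil1964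
open Literature.RepresentationTheory.KonnoKonno2007 hiding LetterKind letterOf letterGen letterOf_boost letterOf_torus letterOf_torus_eq
  letterGen_boost letterGen_torus letterGen_mem_lie exp_smul_letterGen
open Literature.RepresentationTheory.KonnoKonno2007.RealDualPair
open Literature.RepresentationTheory.KonnoKonno2007.RealDualPair.UForm
open Summit.HodgeConjecture.HodgeConjecture.Cruxes.HLiu418.K2LiuU22AdaptedBasis

namespace Summit.HodgeConjecture.HodgeConjecture.Cruxes.HLiu418.K2LiuWeilDatumSmoothU22

variable {R S : Type*} [Fintype R] [DecidableEq R] [Fintype S] [DecidableEq S]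

/-! ## §1 The frame operators `κOp` on Fock polynomials -/

/-- **`κOp e k (B⁻¹F) = B⁻¹ (vacScalar e k · F ∘ (ι k)⁻¹)`**: the operator of a fixed `k ∈ K × K′` acts on a polynomial × Gaussian vector by the Bargmann
substitution twisted by the vacuum scalar (★ `unitaryOpPi_binvPi`). [cite: Folland1989, Prop. (4.39)] -/
theorem κOp_binvPi (e : VacExponents) (k : DPK (Fin 2) (Fin 2) R S) (F : MvPolynomial (DPIdx (Fin 2) (Fin 2) R S) ℂ) :
    κOp R S e k (binvPi F) =
      binvPi (vacScalar e k • linSubst (star ((dualPairι k : Matrix.unitaryGroup (DPIdx (Fin 2) (Fin 2) R S) ℂ) :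
        Matrix (DPIdx (Fin 2) (Fin 2) R S) (DPIdx (Fin 2) (Fin 2) R S) ℂ)) F) := by
  rw [κOp, _root_.smul_apply, unitaryOpPi_binvPi, binvPi_smul]

/-! ## §2 The boost letters: degree `±2`, explicit symbol -/

/-- **the boost generator on Fock polynomials**: `hypOpGenC p q (B⁻¹F) = B⁻¹(i (Σ_s P_{(p,s),(q,s)} F − Σ_r P_{(p,r),(q,r)} F))`, `P = π z z′ + π⁻¹ ∂ ∂′`
(★ `hypOpGen_binvPi_frame`). [cite: Folland1989, Prop. (4.39)] [cite: KashiwaraVergne1978, §5] -/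
theorem u22LetterOp_boost_gen_binvPi (e : VacExponents) (k : Matrix.unitaryGroup (Fin 2) ℂ × Matrix.unitaryGroup (Fin 2) ℂ) (p q : Fin 2)
    (F : MvPolynomial (DPIdx (Fin 2) (Fin 2) R S) ℂ) :
    (u22LetterOp R S e k (.boost p q)).gen (binvPi F) =
      binvPi (I • ((∑ s : S, hypPairSymb (Sum.inr (Sum.inl (p, s))) (Sum.inl (Sum.inr (q, s))) F) -
        ∑ r : R, hypPairSymb (Sum.inl (Sum.inl (p, r))) (Sum.inr (Sum.inr (q, r))) F)) := by
  show hypOpGenC R S p q (binvPi F) = _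
  rw [hypOpGenC_apply, hypOpGen_binvPi_frame]

/-- **THE BOOST LETTER DERIVATIVE PRESERVES POLYNOMIAL × GAUSSIAN, EXPLICITLY**: for the boost letters of `𝔲(2,2)` (kinds `boost p q`, any frame
`k ∈ U(2) × U(2)`), `dω (B⁻¹F) = κOp e (k,1) (hypOpGenC p q (κOp e (k⁻¹,1) (B⁻¹F))) = B⁻¹F′` with the EXPLICIT polynomial
`F′ = c_k · (i (Σ_s P_s − Σ_r P_r) (c_{k⁻¹} · F ∘ ι(k⁻¹,1)⁻¹)) ∘ ι(k,1)⁻¹` (two Bargmann substitutions around the degree-`±2` symbol).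
[cite: Folland1989, Prop. (4.39)] [cite: KashiwaraVergne1978, §5] -/
theorem u22LetterOp_boost_deriv_binvPi (e : VacExponents) (k : Matrix.unitaryGroup (Fin 2) ℂ × Matrix.unitaryGroup (Fin 2) ℂ) (p q : Fin 2)
    (F : MvPolynomial (DPIdx (Fin 2) (Fin 2) R S) ℂ) :
    (u22LetterOp R S e k (.boost p q)).pre ((u22LetterOp R S e k (.boost p q)).gen ((u22LetterOp R S e k (.boost p q)).post (binvPi F))) =
      binvPi (vacScalar e ((k, 1) : DPK (Fin 2) (Fin 2) R S) •
        linSubst (star ((dualPairι ((k, 1) : DPK (Fin 2) (Fin 2) R S) : Matrix.unitaryGroup (DPIdx (Fin 2) (Fin 2) R S) ℂ) :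
          Matrix (DPIdx (Fin 2) (Fin 2) R S) (DPIdx (Fin 2) (Fin 2) R S) ℂ))
          (I • ((∑ s : S, hypPairSymb (Sum.inr (Sum.inl (p, s))) (Sum.inl (Sum.inr (q, s)))
              (vacScalar e ((k⁻¹, 1) : DPK (Fin 2) (Fin 2) R S) •
                linSubst (star ((dualPairι ((k⁻¹, 1) : DPK (Fin 2) (Fin 2) R S) : Matrix.unitaryGroup (DPIdx (Fin 2) (Fin 2) R S) ℂ) :
                  Matrix (DPIdx (Fin 2) (Fin 2) R S) (DPIdx (Fin 2) (Fin 2) R S) ℂ)) F)) -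
            ∑ r : R, hypPairSymb (Sum.inl (Sum.inl (p, r))) (Sum.inr (Sum.inr (q, r)))
              (vacScalar e ((k⁻¹, 1) : DPK (Fin 2) (Fin 2) R S) •
                linSubst (star ((dualPairι ((k⁻¹, 1) : DPK (Fin 2) (Fin 2) R S) : Matrix.unitaryGroup (DPIdx (Fin 2) (Fin 2) R S) ℂ) :
                  Matrix (DPIdx (Fin 2) (Fin 2) R S) (DPIdx (Fin 2) (Fin 2) R S) ℂ)) F)))) := by
  show κOp R S e (k, 1) (hypOpGenC R S p q (κOp R S e (k⁻¹, 1) (binvPi F))) = _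
  rw [κOp_binvPi, hypOpGenC_apply, hypOpGen_binvPi_frame, κOp_binvPi]

/-! ## §3 The torus letters: diagonal on the Hermite basis -/

/-- **the torus letters act on the Hermite basis by unimodular scalars** (degree-preserving): `torusKOp e a b s h_α = (phase) • h_α`
(★ `torusOpPi_hermitePi`). [cite: Folland1989, §1.7] -/
theorem torusKOp_hermitePi (e : VacExponents) (a b : Fin 2 → ℝ) (s : ℝ) (α : DPIdx (Fin 2) (Fin 2) R S →₀ ℕ) :
    torusKOp R S e a b s (hermitePi α) =
      (Complex.exp ((vacRate e a b * s : ℝ) * I) * torusPhase (s • torusIdxWt R S a b) α) • hermitePi α := by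
  rw [torusKOp, _root_.smul_apply, torusOpPi_hermitePi, smul_smul]

/-- **THE TORUS LETTERS PRESERVE EACH HERMITE LINE UP TO THE FRAME**: for the torus letters of `𝔲(2,2)` (kinds `torus a b`, frame `k`),
`(letter).op s = κOp (k,1) ∘ torusKOp e a b s ∘ κOp (k⁻¹,1)` and the middle factor is diagonal on the Hermite basis (`torusKOp_hermitePi`) while the outer
factors are Bargmann substitutions (`κOp_binvPi`) — so polynomial × Gaussian is preserved, degree by degree. [cite: Folland1989, §1.7, Prop. (4.39)] -/
theorem u22LetterOp_torus_op_eq (e : VacExponents) (k : Matrix.unitaryGroup (Fin 2) ℂ × Matrix.unitaryGroup (Fin 2) ℂ) (a b : Fin 2 → ℝ) (s : ℝ)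
    (f : SchwartzMap (DPIdx (Fin 2) (Fin 2) R S → ℝ) ℂ) :
    (u22LetterOp R S e k (.torus a b)).op s f = κOp R S e (k, 1) (torusKOp R S e a b s (κOp R S e (k⁻¹, 1) f)) := rfl

end Summit.HodgeConjecture.HodgeConjecture.Cruxes.HLiu418.K2LiuWeilDatumSmoothU22

end
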